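import Literature.Barriers.NavierStokesRegularity.NavierStokesInequalitySwirlLaplacian
import HarnessLib

/-!
# Compactness margins of a structure: `f ≥ c`, `f² - |v|² ≥ m`, `Lf ≥ c₀` on `supp φ`

Barrier catalogue support file for `NavierStokesRegularity` (D-0021), on the discharge path of
fact D-II `Literature.Barriers.NavierStokesRegularity.NSIProfiles_of_arrangement`
(`NavierStokesInequalityProfiles`; W. S. Ożański, arXiv:1709.00602v4, §4, Lemma 4.1 = held
plain-text "Lemma 8"). The time-dependent profiles `hᵢ,ₜ² = fᵢ² - 2tδφᵢ (+ ∫₀ᵗ v₂·F[v₁,h₁,ₛ] ds)`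
of Lemma 4.1 and their approximations `qᵏᵢ,ₜ` ((4.16)) differ from `fᵢ` only on the compact
set `supp φᵢ ⊆ Uᵢ`, and every smallness condition on `δ` (and largeness of `k`) in §4 is a
margin obtained by compactness there: "since `f₁ > 0` in `U₁` we can take `δ ∈ (0,1)` such
that `δ < min_{supp φ₁} |f₁² - |v₁|²|/2(T+2)` to obtain `h₁,ₜ > |v₁|` in `supp φ₁`" (proof of
Lemma 4.1). This file PROVES these margins for a structure `(v,f,φ)` on `U`
(`IsNSIStructure`):

* `isCompact_tsupport_φ` — `supp φ` is compact (closed in the compact `Ū`, inside `U`);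
* `f_pos`, `exists_le_f_of_mem_tsupport_φ` — `f > 0` on `U`, and `f ≥ c > 0` on `supp φ`;
* `exists_sq_gap` — **`f² - |v|² ≥ m > 0` on `supp φ`** (the printed minimum);
* `exists_opL_ge`, `exists_opL_ge_of_lt_one` — **`Lf ≥ c₀ > 0` on `supp φ ∩ {φ ≤ θ}`**
  (`θ = 1/2`, resp. any `θ < 1`), a compact subset of
  `U ∖ {φ = 1}` where `Lf > 0` (Definition 3.3). This is the margin that keeps `L(Q) ≥ 0` for
  `C²`-small perturbations `Q` of `f` supported in `supp φ` on the region `{φ ≤ θ}`; the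
  printed claim of Lemma 4.1 that `(vᵢ, hᵢ,ₜ, φᵢ)` is again a structure — `L hᵢ,ₜ > 0` on all of
  `Uᵢ ∖ {φᵢ = 1}` — has no such margin near `∂{φᵢ = 1}` for a general structure in the sense of
  Definition 3.3, which is why the tree's profile data (`IsNSIProfileData`) only ask for
  `Q L(Q) ≥ 0` off a closed set `Cᵢ ⊇ supp vᵢ` of one's choosing (e.g. `Cᵢ = {φᵢ ≥ 3/4}`, off
  which `vᵢ = 0`, `v_eq_zero_of_lt`, and on which the printed `-2δφᵢ` leaves the slack `-3δ/2`).

## Mathlib search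

`IsCompact.exists_isMinOn`, `IsCompact.of_isClosed_subset`, `IsCompact.inter_right`,
`isClosed_le` (used); tree: `continuousAt_opL`, `IsNSIStructure.opL_pos`
(`NavierStokesInequalitySwirlLaplacian`, `NavierStokesInequalityArrangement`).

## References

* W. S. Ożański, *On weak solutions to the Navier–Stokes inequality with internal
  singularities*, arXiv:1709.00602v4, §3.4 Definition 3.3, §4 Lemma 4.1 and its proof,
  (4.18)–(4.19). [`Ozanski2017NSISingular`] (Held rendering: Definition 5, Lemma 8.)
* V. Scheffer, *A solution to the Navier–Stokes inequality with an internal singularity*,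
  Comm. Math. Phys. 101 (1985), Lemma 3.1 ((3.8)–(3.15)). [`Scheffer1985`]
-/

noncomputable section

open Set Function Filter Topology TopologicalSpace Metric
open scoped ContDiff

namespace Literature.Barriers.NavierStokesRegularity

open Literature.Analysis.FluidPDE

namespace IsNSIStructure

variable {U : Set (ℝ × ℝ)} {v : ℝ × ℝ → ℝ × ℝ} {f φ : ℝ × ℝ → ℝ}

/-- **`supp φ` is compact** for a structure (`φ ∈ C_c^∞(U)`: closed, inside the compact `Ū`).
[cite: Ozanski2017NSISingular, Definition 3.3] -/
theorem isCompact_tsupport_φ (h : IsNSIStructure U v f φ) : IsCompact (tsupport φ) :=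
  h.isCompact_closure.of_isClosed_subset (isClosed_tsupport φ) (h.tsupport_φ.trans subset_closure)

/-- **`f > 0` in `U`** (`f ≥ 0` and `f² > |v|² ≥ 0`; Ożański: "since `f₁ > 0` in `U₁`").
[cite: Ozanski2017NSISingular, Lemma 4.1 (proof)] -/
theorem f_pos (h : IsNSIStructure U v f φ) {q : ℝ × ℝ} (hq : q ∈ U) : 0 < f q := by
  have h1 := h.sq_lt q hq
  have h2 := h.f_nonneg q
  rcases h2.lt_or_eq with h3 | h3
  · exact h3
  · rw [← h3] at h1
    nlinarith [sq_nonneg (v q).1, sq_nonneg (v q).2]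

/-- **`f ≥ c > 0` on `supp φ`** (a continuous positive function on a compact subset of `U`).
[cite: Ozanski2017NSISingular, Lemma 4.1 (proof)] -/
theorem exists_le_f_of_mem_tsupport_φ (h : IsNSIStructure U v f φ) :
    ∃ c > 0, ∀ q ∈ tsupport φ, c ≤ f q := by
  rcases (tsupport φ).eq_empty_or_nonempty with hE | hE
  · exact ⟨1, one_pos, fun q hq => by simp [hE] at hq⟩
  · obtain ⟨q₀, hq₀, hmin⟩ := h.isCompact_tsupport_φ.exists_isMinOn hE
      h.f_smooth.continuous.continuousOn
    exact ⟨f q₀, h.f_pos (h.tsupport_φ hq₀), fun q hq => hmin hq⟩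

/-- **The gap `f² - |v|² ≥ m > 0` on `supp φ`** (Ożański, proof of Lemma 4.1:
`δ < min_{supp φ₁} |f₁² - |v₁|²|/2(T+2)`; the minimum of a continuous positive function on a
compact subset of `U`). [cite: Ozanski2017NSISingular, Lemma 4.1 (proof)] -/
theorem exists_sq_gap (h : IsNSIStructure U v f φ) :
    ∃ m > 0, ∀ q ∈ tsupport φ, (v q).1 ^ 2 + (v q).2 ^ 2 + m ≤ f q ^ 2 := by
  set g : ℝ × ℝ → ℝ := fun q => f q ^ 2 - ((v q).1 ^ 2 + (v q).2 ^ 2) with hg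
  have hgc : Continuous g :=
    (h.f_smooth.continuous.pow 2).sub (((continuous_fst.comp h.v_smooth.continuous).pow 2).add
      ((continuous_snd.comp h.v_smooth.continuous).pow 2))
  rcases (tsupport φ).eq_empty_or_nonempty with hE | hE
  · exact ⟨1, one_pos, fun q hq => by simp [hE] at hq⟩
  · obtain ⟨q₀, hq₀, hmin⟩ := h.isCompact_tsupport_φ.exists_isMinOn hE hgc.continuousOn
    refine ⟨g q₀, sub_pos.2 (h.sq_lt q₀ (h.tsupport_φ hq₀)), fun q hq => ?_⟩
    have := hmin hq
    simp only [hg, mem_setOf_eq] at this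
    linarith

/-- `supp φ ∩ {φ ≤ 1/2}` is a compact subset of `U ∖ {φ = 1}`. [folklore] -/
theorem isCompact_tsupport_φ_inter (h : IsNSIStructure U v f φ) :
    IsCompact (tsupport φ ∩ {q | φ q ≤ 1 / 2}) :=
  h.isCompact_tsupport_φ.inter_right (isClosed_le h.φ_smooth.continuous continuous_const)

/-- **`Lf ≥ c₀ > 0` on `supp φ ∩ {φ ≤ 1/2}`**: there `φ ≠ 1`, so `Lf > 0` by Definition 3.3,
and `Lf` is continuous off the axis; a compact set gives a positive minimum. (The margin that
keeps `L(Q) ≥ 0` on `{φ ≤ 1/2}` for `C²`-small perturbations `Q` of `f` supported in `supp φ`,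
replacing the printed claim of Lemma 4.1 that the perturbed triples are again structures.)
[cite: Ozanski2017NSISingular, Definition 3.3 and Lemma 4.1] -/
theorem exists_opL_ge (h : IsNSIStructure U v f φ) :
    ∃ c₀ > 0, ∀ q ∈ tsupport φ, φ q ≤ 1 / 2 → c₀ ≤ opL f q := by
  set K : Set (ℝ × ℝ) := tsupport φ ∩ {q | φ q ≤ 1 / 2} with hK
  have hKc : IsCompact K := h.isCompact_tsupport_φ_inter
  have hKU : K ⊆ U := fun q hq => h.tsupport_φ hq.1
  have hcont : ContinuousOn (opL f) K := fun q hq =>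
    (continuousAt_opL h.f_smooth (h.subset_halfPlane (hKU hq)).ne').continuousWithinAt
  have hpos : ∀ q ∈ K, 0 < opL f q := fun q hq =>
    h.opL_pos q (hKU hq) (by have := hq.2; simp only [mem_setOf_eq] at this; linarith)
  rcases K.eq_empty_or_nonempty with hE | hE
  · refine ⟨1, one_pos, fun q hq hφ => ?_⟩
    have : q ∈ K := ⟨hq, hφ⟩
    simp [hE] at this
  · obtain ⟨q₀, hq₀, hmin⟩ := hKc.exists_isMinOn hE hcont
    exact ⟨opL f q₀, hpos q₀ hq₀, fun q hq hφ => hmin (show q ∈ K from ⟨hq, hφ⟩)⟩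

/-- `supp φ ∩ {φ ≤ θ}` is compact for every threshold `θ`. [folklore] -/
theorem isCompact_tsupport_φ_inter_le (h : IsNSIStructure U v f φ) (θ : ℝ) :
    IsCompact (tsupport φ ∩ {q | φ q ≤ θ}) :=
  h.isCompact_tsupport_φ.inter_right (isClosed_le h.φ_smooth.continuous continuous_const)

/-- **`Lf ≥ c₀ > 0` on `supp φ ∩ {φ ≤ θ}` for every threshold `θ < 1`** (same proof as for
`θ = 1/2`; with `θ = 3/4`, say, the closed set `Cᵢ = {φᵢ ≥ 3/4} ⊇ supp vᵢ` leaves the slack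
`-2δφᵢ ≤ -3δ/2` on `Cᵢ` and this margin off it). [cite: Ozanski2017NSISingular, Definition 3.3 and Lemma 4.1] -/
theorem exists_opL_ge_of_lt_one (h : IsNSIStructure U v f φ) {θ : ℝ} (hθ : θ < 1) :
    ∃ c₀ > 0, ∀ q ∈ tsupport φ, φ q ≤ θ → c₀ ≤ opL f q := by
  set K : Set (ℝ × ℝ) := tsupport φ ∩ {q | φ q ≤ θ} with hK
  have hKc : IsCompact K := h.isCompact_tsupport_φ_inter_le θ
  have hKU : K ⊆ U := fun q hq => h.tsupport_φ hq.1
  have hcont : ContinuousOn (opL f) K := fun q hq =>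
    (continuousAt_opL h.f_smooth (h.subset_halfPlane (hKU hq)).ne').continuousWithinAt
  have hpos : ∀ q ∈ K, 0 < opL f q := fun q hq =>
    h.opL_pos q (hKU hq) (by have := hq.2; simp only [mem_setOf_eq] at this; linarith)
  rcases K.eq_empty_or_nonempty with hE | hE
  · refine ⟨1, one_pos, fun q hq hφ => ?_⟩
    have : q ∈ K := ⟨hq, hφ⟩
    simp [hE] at this
  · obtain ⟨q₀, hq₀, hmin⟩ := hKc.exists_isMinOn hE hcont
    exact ⟨opL f q₀, hpos q₀ hq₀, fun q hq hφ => hmin (show q ∈ K from ⟨hq, hφ⟩)⟩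

/-- **`φ < 1` off the closed set `{φ ≥ θ}`, `θ ≤ 1`, hence `v = 0` there** (`supp v ⊆ {φ = 1}`):
the region off `Cᵢ = {φᵢ ≥ θ}` carries no planar field. [cite: Ozanski2017NSISingular, Definition 3.3] -/
theorem v_eq_zero_of_lt (h : IsNSIStructure U v f φ) {q : ℝ × ℝ} (hq : φ q < 1) : v q = 0 :=
  image_eq_zero_of_notMem_tsupport fun h' => (ne_of_lt hq) (h.tsupport_v h')

/-- On `supp φ` the profile `f` is bounded: `f ≤ M`. [folklore] -/
theorem exists_f_le (h : IsNSIStructure U v f φ) : ∃ M : ℝ, ∀ q, f q ≤ M := by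
  have hfc : HasCompactSupport f := by
    rw [HasCompactSupport, h.tsupport_f]; exact h.isCompact_closure
  obtain ⟨M, hM⟩ := hfc.exists_bound_of_continuous h.f_smooth.continuous
  exact ⟨M, fun q => (le_abs_self _).trans ((Real.norm_eq_abs _).symm.le.trans (hM q))⟩

end IsNSIStructure

end Literature.Barriers.NavierStokesRegularity

end
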